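import Summits.AnomalousDissipation.AnomalousDissipation.Theorems.TaylorCertificatesTargetImpliesSteadyDirect
import Literature.Analysis.FluidPDE.StatisticalSolutionEnergyEq
import Literature.Analysis.FluidPDE.CylindricalGenerator

/-!
# `TaylorCertificates.FloorCertificateEnsembleCeiling` (stmt-AnomalousDissipation-14086) — negative side VII:
# NO TAME LIMITS (an Onsager-type gate on the FLOOR half of `X`)

cdisprove seat `refuter-cdisprove-stmt-AnomalousDissipation-14086-g3-0` (generation 3, 2026-08-16).

The FLOOR half of `X` at a force `f` (a cylindrical certificate `ε₀ ≤ ν‖∇u‖² + ⟨F_ν(u),Φ₁'(u)⟩ + 2θ₁((u,f) − ν‖∇u‖²)`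
on the Leray ball, one per `ν < ν₀`) makes every steady weak solution `u ∈ V` of `NS_ν(f)` `ε₀`-LOUD
(`TargetImpliesSteadyDirect.floor_le_dissipation_of_steady`). This file records the elementary but sharp consequence
that such a loud steady state keeps a UNIFORM `L²`-DISTANCE from every finite-enstrophy steady weak solution of the
FORCED EULER equations of the same force:

* `pairing_eq_zero_of_eulerSteady` — a steady weak Euler solution `U ∈ V` of force `f` does no work: `(U, f) = 0`
  (the tree's steady energy equation `ν‖∇u‖² = (u,f)`, `IsSteadyWeakSolution.energy_eq'`, read at `ν = 0`; this is
  where `U ∈ V = H¹` enters — the Onsager-subcritical side);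
* `steady_dissipation_le_dist_eulerSteady` — **moat lemma**: for a steady weak solution `u ∈ V` of `NS_ν(f)` and any
  such `U`, `ν‖∇u‖² = (u,f) = (u − U, f) ≤ ‖f‖₂ ‖u − U‖`: the dissipation of a steady state is at most `‖f‖₂` times
  its `L²`-distance to the tame steady Euler solutions of its force;
* `floor_moat` — under the floor at `(f, ν)`: `ε₀ ≤ ‖f‖₂ ‖u − U‖` for every steady `u ∈ V` of `NS_ν(f)` and every
  steady weak Euler `U ∈ V` of `f` (an `ε₀/‖f‖₂`-moat around the whole tame Euler-steady set, uniformly in `ν < ν₀`);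
* `floorFamily_false_of_tameApproach`, `xBody_false_of_tameApproach` — KILL SHAPE: if at arbitrarily small `ν` some
  steady state of `NS_ν(f)` comes arbitrarily `L²`-close to some steady weak Euler solution in `V` of `f`
  ("tame approach"), the floor family — hence the `∀ ν`-body of `X` — is FALSE at `f` (no ceiling needed);
* `isSteadyWeakSolution_zero_of_tendsto` — strong `L²` limits of steady states along `ν_n → 0` are steady weak Euler
  solutions of the same force (continuity of the tested generator on `H`, `continuous_inertialPairing_coe` /
  `continuous_pairing_coe`: all derivatives sit on the test field);
* `floorFamily_false_of_tameLimit`, `xBody_false_of_tameLimit` — hence: if a sequence of steady states `u_n ∈ V` of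
  `NS_{ν_n}(f)`, `ν_n → 0`, converges in `L²` to a field `U` of FINITE ENSTROPHY, the floor family and `X`'s body are
  false at `f`;
* `floorCertificateEnsembleCeiling_false_of_forall_tameApproach` — the pincer form on `X` itself.

READING (for the line and the numerics, Cruxes/FloorCertificateEnsembleCeiling/Disproof.lean §K): under `X(f)` the
steady states of `NS_ν(f)` in the ball are `ε₀`-loud with `‖∇u_ν‖² ≥ ε₀/ν → ∞` and `|u_ν|² ≤ E`; this file adds that
they can accumulate in `L²` ONLY at infinite-enstrophy fields (or not at all): the scenario "smooth skeleton +
vanishing-energy, exploding-enstrophy fluctuations" is excluded, exactly as Onsager's heuristics demand (a positive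
work `(U,f) = lim ν‖∇u_ν‖² ≥ ε₀` at the limit needs an Onsager-rough limit; `H¹` is far on the subcritical side, which
is what the tree can certify today). For a Newton-continued steady branch this is a concrete test: convergence of the
profile in `L²` towards a finite-enstrophy field forces `ν‖∇u_ν‖² → 0` (QUIET), whatever the certificate.

Def-free; imports `TaylorCertificatesTargetImpliesSteadyDirect` + Literature only. Nothing here asserts a Theses
statement.
-/

noncomputable section

set_option linter.dupNamespace false

open MeasureTheory UnitAddTorus Filter Topology
open scoped InnerProductSpace ENNReal

namespace Summit.AnomalousDissipation.AnomalousDissipation.Theorems.FloorCertificateEnsembleCeiling.Negative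

open Literature.Analysis.FunctionSpaces Literature.Analysis.FluidPDE
open Summit.AnomalousDissipation.AnomalousDissipation.Theses.TaylorCertificates
open Summit.AnomalousDissipation.AnomalousDissipation.Theorems.TargetImpliesSteadyDirect

/-! ## Tame steady Euler solutions do no work -/

/-- **A finite-enstrophy steady weak Euler solution of force `f` does no work**: `(U, f) = 0`
(the steady energy equation `ν‖∇U‖² = (U,f)` of the tree at `ν = 0`). -/
theorem pairing_eq_zero_of_eulerSteady {f : (UnitAddTorus (Fin 3) → EuclideanSpace ℝ (Fin 3))} (hf : MemLp f 2 volume) {U : Torus.energySpace (Fin 3)}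
    (hUV : (U : Lp (EuclideanSpace ℝ (Fin 3)) 2 (volume : Measure (UnitAddTorus (Fin 3)))) ∈ Torus.energySpaceV (Fin 3)) (hU : Torus.IsSteadyWeakSolution 0 f U) :
    Torus.pairing (U : Lp (EuclideanSpace ℝ (Fin 3)) 2 (volume : Measure (UnitAddTorus (Fin 3)))) f = 0 := by
  have h := Torus.IsSteadyWeakSolution.energy_eq' (d := Fin 3) (by simp) hf hUV hU
  rw [zero_mul] at h
  exact h.symm

/-- The pairing is additive in the state: `(u − U, f) = (u, f) − (U, f)` on `H`. -/
theorem pairing_coe_sub {f : (UnitAddTorus (Fin 3) → EuclideanSpace ℝ (Fin 3))} (hf : MemLp f 2 volume) (u U : Torus.energySpace (Fin 3)) :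
    Torus.pairing ((u - U : Torus.energySpace (Fin 3)) : Lp (EuclideanSpace ℝ (Fin 3)) 2 (volume : Measure (UnitAddTorus (Fin 3)))) f = Torus.pairing (u : Lp (EuclideanSpace ℝ (Fin 3)) 2 (volume : Measure (UnitAddTorus (Fin 3)))) f - Torus.pairing (U : Lp (EuclideanSpace ℝ (Fin 3)) 2 (volume : Measure (UnitAddTorus (Fin 3)))) f := by
  rw [Torus.pairing_eq_inner hf, Torus.pairing_eq_inner hf, Torus.pairing_eq_inner hf, Submodule.coe_sub,
    inner_sub_left]

/-! ## The moat lemma -/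

/-- **Moat lemma**: the dissipation of a steady weak solution `u ∈ V` of `NS_ν(f)` is at most `‖f‖₂` times its
`L²`-distance to ANY finite-enstrophy steady weak Euler solution `U` of the same force:
`ν‖∇u‖² = (u, f) = (u − U, f) ≤ ‖f‖₂ ‖u − U‖`. -/
theorem steady_dissipation_le_dist_eulerSteady {ν : ℝ} {f : (UnitAddTorus (Fin 3) → EuclideanSpace ℝ (Fin 3))} (hf : MemLp f 2 volume) {u U : Torus.energySpace (Fin 3)}
    (huV : (u : Lp (EuclideanSpace ℝ (Fin 3)) 2 (volume : Measure (UnitAddTorus (Fin 3)))) ∈ Torus.energySpaceV (Fin 3)) (hu : Torus.IsSteadyWeakSolution ν f u)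
    (hUV : (U : Lp (EuclideanSpace ℝ (Fin 3)) 2 (volume : Measure (UnitAddTorus (Fin 3)))) ∈ Torus.energySpaceV (Fin 3)) (hU : Torus.IsSteadyWeakSolution 0 f U) :
    ν * (Torus.eGradNormSq ((u : Lp (EuclideanSpace ℝ (Fin 3)) 2 (volume : Measure (UnitAddTorus (Fin 3)))) : (UnitAddTorus (Fin 3) → EuclideanSpace ℝ (Fin 3)))).toReal ≤ ‖hf.toLp f‖ * ‖u - U‖ := by
  have h1 : ν * (Torus.eGradNormSq ((u : Lp (EuclideanSpace ℝ (Fin 3)) 2 (volume : Measure (UnitAddTorus (Fin 3)))) : (UnitAddTorus (Fin 3) → EuclideanSpace ℝ (Fin 3)))).toReal = Torus.pairing (u : Lp (EuclideanSpace ℝ (Fin 3)) 2 (volume : Measure (UnitAddTorus (Fin 3)))) f :=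
    Torus.IsSteadyWeakSolution.energy_eq' (d := Fin 3) (by simp) hf huV hu
  have h2 : Torus.pairing (u : Lp (EuclideanSpace ℝ (Fin 3)) 2 (volume : Measure (UnitAddTorus (Fin 3)))) f = Torus.pairing ((u - U : Torus.energySpace (Fin 3)) : Lp (EuclideanSpace ℝ (Fin 3)) 2 (volume : Measure (UnitAddTorus (Fin 3)))) f := by
    rw [pairing_coe_sub hf, pairing_eq_zero_of_eulerSteady hf hUV hU, sub_zero]
  have h3 : Torus.pairing ((u - U : Torus.energySpace (Fin 3)) : Lp (EuclideanSpace ℝ (Fin 3)) 2 (volume : Measure (UnitAddTorus (Fin 3)))) f ≤ ‖u - U‖ * ‖hf.toLp f‖ :=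
    (le_abs_self _).trans (Torus.abs_pairing_coe_le hf (u - U))
  rw [h1, h2, mul_comm]
  exact h3

/-- **The floor digs a moat around the tame Euler-steady set.** Under X's FLOOR inequality at `(f, ν)` (any
`θ₁`), every steady weak solution `u ∈ V` of `NS_ν(f)` satisfies `ε₀ ≤ ‖f‖₂ ‖u − U‖` for every finite-enstrophy
steady weak Euler solution `U` of `f`. -/
theorem floor_moat {ν : ℝ} (hν : 0 < ν) {f : (UnitAddTorus (Fin 3) → EuclideanSpace ℝ (Fin 3))} (hf : MemLp f 2 volume) {ε₀ θ₁ : ℝ}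
    {Φ₁ : Torus.CylindricalTest (Fin 3)}
    (hfloor : ∀ u : Torus.energySpace (Fin 3), Torus.eGradNormSq ((u : Lp (EuclideanSpace ℝ (Fin 3)) 2 (volume : Measure (UnitAddTorus (Fin 3)))) : (UnitAddTorus (Fin 3) → EuclideanSpace ℝ (Fin 3))) ≠ ⊤ → ‖u‖ ^ 2 ≤ 16 * (∫ x, ‖f x‖ ^ 2) / ν ^ 2 →
      ε₀ ≤ ν * (Torus.eGradNormSq ((u : Lp (EuclideanSpace ℝ (Fin 3)) 2 (volume : Measure (UnitAddTorus (Fin 3)))) : (UnitAddTorus (Fin 3) → EuclideanSpace ℝ (Fin 3)))).toReal + Torus.nsGeneratorPairing ν f u (Φ₁.grad u) +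
        2 * θ₁ * (Torus.pairing (u : Lp (EuclideanSpace ℝ (Fin 3)) 2 (volume : Measure (UnitAddTorus (Fin 3)))) f - ν * (Torus.eGradNormSq ((u : Lp (EuclideanSpace ℝ (Fin 3)) 2 (volume : Measure (UnitAddTorus (Fin 3)))) : (UnitAddTorus (Fin 3) → EuclideanSpace ℝ (Fin 3)))).toReal))
    {u : Torus.energySpace (Fin 3)} (huV : (u : Lp (EuclideanSpace ℝ (Fin 3)) 2 (volume : Measure (UnitAddTorus (Fin 3)))) ∈ Torus.energySpaceV (Fin 3)) (hu : Torus.IsSteadyWeakSolution ν f u)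
    {U : Torus.energySpace (Fin 3)} (hUV : (U : Lp (EuclideanSpace ℝ (Fin 3)) 2 (volume : Measure (UnitAddTorus (Fin 3)))) ∈ Torus.energySpaceV (Fin 3)) (hU : Torus.IsSteadyWeakSolution 0 f U) :
    ε₀ ≤ ‖hf.toLp f‖ * ‖u - U‖ :=
  (floor_le_dissipation_of_steady hν hf hfloor huV hu).trans (steady_dissipation_le_dist_eulerSteady hf huV hu hUV hU)

/-! ## Kill shape: tame approach -/

/-- **Tame approach kills the floor family.** If at arbitrarily small viscosity some steady weak solution `u ∈ V`
of `NS_ν(f)` is arbitrarily `L²`-close to some finite-enstrophy steady weak Euler solution `U` of `f`, then NO floor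
family `(Φ₁^ν, θ₁^ν ≤ 0)_{ν<ν₀}` with a positive budget exists at `f`. -/
theorem floorFamily_false_of_tameApproach {f : (UnitAddTorus (Fin 3) → EuclideanSpace ℝ (Fin 3))} (hf : MemLp f 2 volume)
    (happ : ∀ δ ν₀ : ℝ, 0 < δ → 0 < ν₀ → ∃ ν : ℝ, 0 < ν ∧ ν < ν₀ ∧
      ∃ u : Torus.energySpace (Fin 3), (u : Lp (EuclideanSpace ℝ (Fin 3)) 2 (volume : Measure (UnitAddTorus (Fin 3)))) ∈ Torus.energySpaceV (Fin 3) ∧ Torus.IsSteadyWeakSolution ν f u ∧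
        ∃ U : Torus.energySpace (Fin 3), (U : Lp (EuclideanSpace ℝ (Fin 3)) 2 (volume : Measure (UnitAddTorus (Fin 3)))) ∈ Torus.energySpaceV (Fin 3) ∧ Torus.IsSteadyWeakSolution 0 f U ∧ ‖u - U‖ < δ) :
    ¬ ∃ (ε₀ ν₀ : ℝ), 0 < ε₀ ∧ 0 < ν₀ ∧ ∀ ν : ℝ, 0 < ν → ν < ν₀ →
      ∃ (Φ₁ : Torus.CylindricalTest (Fin 3)) (θ₁ : ℝ), θ₁ ≤ 0 ∧ ∀ u : Torus.energySpace (Fin 3),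
        Torus.eGradNormSq ((u : Lp (EuclideanSpace ℝ (Fin 3)) 2 (volume : Measure (UnitAddTorus (Fin 3)))) : (UnitAddTorus (Fin 3) → EuclideanSpace ℝ (Fin 3))) ≠ ⊤ → ‖u‖ ^ 2 ≤ 16 * (∫ x, ‖f x‖ ^ 2) / ν ^ 2 →
        ε₀ ≤ ν * (Torus.eGradNormSq ((u : Lp (EuclideanSpace ℝ (Fin 3)) 2 (volume : Measure (UnitAddTorus (Fin 3)))) : (UnitAddTorus (Fin 3) → EuclideanSpace ℝ (Fin 3)))).toReal + Torus.nsGeneratorPairing ν f u (Φ₁.grad u) +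
          2 * θ₁ * (Torus.pairing (u : Lp (EuclideanSpace ℝ (Fin 3)) 2 (volume : Measure (UnitAddTorus (Fin 3)))) f - ν * (Torus.eGradNormSq ((u : Lp (EuclideanSpace ℝ (Fin 3)) 2 (volume : Measure (UnitAddTorus (Fin 3)))) : (UnitAddTorus (Fin 3) → EuclideanSpace ℝ (Fin 3)))).toReal) := by
  rintro ⟨ε₀, ν₀, hε₀, hν₀, h⟩
  set F : ℝ := ‖hf.toLp f‖ with hF
  have hF0 : 0 ≤ F := norm_nonneg _
  have hδ : 0 < ε₀ / (2 * (F + 1)) := by positivity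
  obtain ⟨ν, hν, hνν₀, u, huV, hu, U, hUV, hU, hdist⟩ := happ _ _ hδ hν₀
  obtain ⟨Φ₁, θ₁, -, hfloor⟩ := h ν hν hνν₀
  have hmoat := floor_moat hν hf hfloor huV hu hUV hU
  have h1 : F * ‖u - U‖ ≤ F * (ε₀ / (2 * (F + 1))) := mul_le_mul_of_nonneg_left hdist.le hF0
  have h2 : F * (ε₀ / (2 * (F + 1))) ≤ ε₀ / 2 := by
    rw [mul_div_assoc', div_le_div_iff₀ (by positivity) (by positivity)]
    nlinarith
  linarith

/-- **Tame approach kills `X` at its force** (the `∀ ν`-body of `FloorCertificateEnsembleCeiling` at `f`; the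
ceiling half is not used). -/
theorem xBody_false_of_tameApproach {f : (UnitAddTorus (Fin 3) → EuclideanSpace ℝ (Fin 3))} (hf : MemLp f 2 volume)
    (happ : ∀ δ ν₀ : ℝ, 0 < δ → 0 < ν₀ → ∃ ν : ℝ, 0 < ν ∧ ν < ν₀ ∧
      ∃ u : Torus.energySpace (Fin 3), (u : Lp (EuclideanSpace ℝ (Fin 3)) 2 (volume : Measure (UnitAddTorus (Fin 3)))) ∈ Torus.energySpaceV (Fin 3) ∧ Torus.IsSteadyWeakSolution ν f u ∧
        ∃ U : Torus.energySpace (Fin 3), (U : Lp (EuclideanSpace ℝ (Fin 3)) 2 (volume : Measure (UnitAddTorus (Fin 3)))) ∈ Torus.energySpaceV (Fin 3) ∧ Torus.IsSteadyWeakSolution 0 f U ∧ ‖u - U‖ < δ) :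
    ¬ ∃ (ε₀ E ν₀ : ℝ), 0 < ε₀ ∧ 0 < ν₀ ∧ ∀ ν : ℝ, 0 < ν → ν < ν₀ →
      (∃ (Φ₁ : Torus.CylindricalTest (Fin 3)) (θ₁ : ℝ), θ₁ ≤ 0 ∧ ∀ u : Torus.energySpace (Fin 3),
        Torus.eGradNormSq ((u : Lp (EuclideanSpace ℝ (Fin 3)) 2 (volume : Measure (UnitAddTorus (Fin 3)))) : (UnitAddTorus (Fin 3) → EuclideanSpace ℝ (Fin 3))) ≠ ⊤ → ‖u‖ ^ 2 ≤ 16 * (∫ x, ‖f x‖ ^ 2) / ν ^ 2 →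
        ε₀ ≤ ν * (Torus.eGradNormSq ((u : Lp (EuclideanSpace ℝ (Fin 3)) 2 (volume : Measure (UnitAddTorus (Fin 3)))) : (UnitAddTorus (Fin 3) → EuclideanSpace ℝ (Fin 3)))).toReal + Torus.nsGeneratorPairing ν f u (Φ₁.grad u) +
          2 * θ₁ * (Torus.pairing (u : Lp (EuclideanSpace ℝ (Fin 3)) 2 (volume : Measure (UnitAddTorus (Fin 3)))) f - ν * (Torus.eGradNormSq ((u : Lp (EuclideanSpace ℝ (Fin 3)) 2 (volume : Measure (UnitAddTorus (Fin 3)))) : (UnitAddTorus (Fin 3) → EuclideanSpace ℝ (Fin 3)))).toReal)) ∧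
      (∀ μ : Measure (Torus.energySpace (Fin 3)), Torus.IsStationaryStatisticalSolution ν f μ →
        Integrable (fun v : Torus.energySpace (Fin 3) => ‖v‖ ^ 2) μ → Torus.ensembleEnergy μ ≤ E) := by
  rintro ⟨ε₀, E, ν₀, hε₀, hν₀, h⟩
  exact floorFamily_false_of_tameApproach hf happ ⟨ε₀, ν₀, hε₀, hν₀, fun ν hν hνν₀ => (h ν hν hνν₀).1⟩

/-! ## Strong `L²` limits of steady states are steady weak Euler solutions -/

/-- The tested generator, unfolded: `⟨F_ν(u), w⟩ = (f,w) + ν (u, Δw) + ∫ (u⊗u):∇w` (definitional). -/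
theorem nsGeneratorPairing_eq_pairing (ν : ℝ) (f : (UnitAddTorus (Fin 3) → EuclideanSpace ℝ (Fin 3))) (u : Torus.energySpace (Fin 3)) (w : (UnitAddTorus (Fin 3) → EuclideanSpace ℝ (Fin 3))) :
    Torus.nsGeneratorPairing ν f u w =
      (∫ x, ⟪f x, w x⟫_ℝ) + ν * Torus.pairing (u : Lp (EuclideanSpace ℝ (Fin 3)) 2 (volume : Measure (UnitAddTorus (Fin 3)))) (Torus.laplacian w) + Torus.inertialPairing (u : Lp (EuclideanSpace ℝ (Fin 3)) 2 (volume : Measure (UnitAddTorus (Fin 3)))) w :=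
  rfl

/-- **Limits of steady states are steady weak Euler solutions.** If `u_n` are steady weak solutions of
`NS_{ν_n}(f)` with `ν_n → 0` and `u_n → U` in `H` (strong `L²`), then `U` is a steady weak solution of the forced
Euler equations of `f` (`IsSteadyWeakSolution 0 f U`): every derivative of the weak form sits on the test field, the
viscous term is `ν_n` times a bounded quantity and the inertial term is a continuous quadratic form on `H`. -/
theorem isSteadyWeakSolution_zero_of_tendsto {f : (UnitAddTorus (Fin 3) → EuclideanSpace ℝ (Fin 3))} {ν : ℕ → ℝ} {u : ℕ → Torus.energySpace (Fin 3)} {U : Torus.energySpace (Fin 3)}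
    (hν : Tendsto ν atTop (𝓝 0)) (hu : ∀ n, Torus.IsSteadyWeakSolution (ν n) f (u n))
    (hlim : Tendsto u atTop (𝓝 U)) : Torus.IsSteadyWeakSolution 0 f U := by
  intro w hw hdw hzw
  have hP : Tendsto (fun n => Torus.pairing ((u n : Torus.energySpace (Fin 3)) : Lp (EuclideanSpace ℝ (Fin 3)) 2 (volume : Measure (UnitAddTorus (Fin 3)))) (Torus.laplacian w)) atTop
      (𝓝 (Torus.pairing (U : Lp (EuclideanSpace ℝ (Fin 3)) 2 (volume : Measure (UnitAddTorus (Fin 3)))) (Torus.laplacian w))) :=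
    ((Torus.continuous_pairing_coe (hw.laplacian.memLp 2)).tendsto U).comp hlim
  have hQ : Tendsto (fun n => Torus.inertialPairing ((u n : Torus.energySpace (Fin 3)) : Lp (EuclideanSpace ℝ (Fin 3)) 2 (volume : Measure (UnitAddTorus (Fin 3)))) w) atTop
      (𝓝 (Torus.inertialPairing (U : Lp (EuclideanSpace ℝ (Fin 3)) 2 (volume : Measure (UnitAddTorus (Fin 3)))) w)) :=
    ((Torus.continuous_inertialPairing_coe hw).tendsto U).comp hlim
  have hνP : Tendsto (fun n => ν n * Torus.pairing ((u n : Torus.energySpace (Fin 3)) : Lp (EuclideanSpace ℝ (Fin 3)) 2 (volume : Measure (UnitAddTorus (Fin 3)))) (Torus.laplacian w)) atTop (𝓝 0) := by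
    simpa using hν.mul hP
  have hsum : Tendsto (fun n => Torus.nsGeneratorPairing (ν n) f (u n) w) atTop
      (𝓝 ((∫ x, ⟪f x, w x⟫_ℝ) + 0 + Torus.inertialPairing (U : Lp (EuclideanSpace ℝ (Fin 3)) 2 (volume : Measure (UnitAddTorus (Fin 3)))) w)) := by
    simp_rw [nsGeneratorPairing_eq_pairing]
    exact (tendsto_const_nhds.add hνP).add hQ
  have hzero : (fun n => Torus.nsGeneratorPairing (ν n) f (u n) w) = fun _ => (0 : ℝ) :=
    funext fun n => hu n w hw hdw hzw
  rw [hzero] at hsum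
  have hval : (∫ x, ⟪f x, w x⟫_ℝ) + 0 + Torus.inertialPairing (U : Lp (EuclideanSpace ℝ (Fin 3)) 2 (volume : Measure (UnitAddTorus (Fin 3)))) w = 0 :=
    (tendsto_nhds_unique tendsto_const_nhds hsum).symm
  rw [nsGeneratorPairing_eq_pairing, zero_mul]
  simpa using hval

/-! ## Kill shape: tame limits -/

/-- **A tame limit of steady states kills the floor family.** If steady weak solutions `u_n ∈ V` of
`NS_{ν_n}(f)`, `ν_n > 0`, `ν_n → 0`, converge in `L²` to a field `U` of FINITE ENSTROPHY (`U ∈ V`), then no floor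
family with positive budget exists at `f`: `U` is a steady weak Euler solution of `f`
(`isSteadyWeakSolution_zero_of_tendsto`), does no work, and the loud `u_n` would have to stay `ε₀/‖f‖₂` away from it
(`floor_moat`). -/
theorem floorFamily_false_of_tameLimit {f : (UnitAddTorus (Fin 3) → EuclideanSpace ℝ (Fin 3))} (hf : MemLp f 2 volume) {ν : ℕ → ℝ} {u : ℕ → Torus.energySpace (Fin 3)} {U : Torus.energySpace (Fin 3)}
    (hνpos : ∀ n, 0 < ν n) (hν : Tendsto ν atTop (𝓝 0))
    (huV : ∀ n, ((u n : Torus.energySpace (Fin 3)) : Lp (EuclideanSpace ℝ (Fin 3)) 2 (volume : Measure (UnitAddTorus (Fin 3)))) ∈ Torus.energySpaceV (Fin 3)) (hu : ∀ n, Torus.IsSteadyWeakSolution (ν n) f (u n))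
    (hUV : (U : Lp (EuclideanSpace ℝ (Fin 3)) 2 (volume : Measure (UnitAddTorus (Fin 3)))) ∈ Torus.energySpaceV (Fin 3)) (hlim : Tendsto u atTop (𝓝 U)) :
    ¬ ∃ (ε₀ ν₀ : ℝ), 0 < ε₀ ∧ 0 < ν₀ ∧ ∀ ν : ℝ, 0 < ν → ν < ν₀ →
      ∃ (Φ₁ : Torus.CylindricalTest (Fin 3)) (θ₁ : ℝ), θ₁ ≤ 0 ∧ ∀ u : Torus.energySpace (Fin 3),
        Torus.eGradNormSq ((u : Lp (EuclideanSpace ℝ (Fin 3)) 2 (volume : Measure (UnitAddTorus (Fin 3)))) : (UnitAddTorus (Fin 3) → EuclideanSpace ℝ (Fin 3))) ≠ ⊤ → ‖u‖ ^ 2 ≤ 16 * (∫ x, ‖f x‖ ^ 2) / ν ^ 2 →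
        ε₀ ≤ ν * (Torus.eGradNormSq ((u : Lp (EuclideanSpace ℝ (Fin 3)) 2 (volume : Measure (UnitAddTorus (Fin 3)))) : (UnitAddTorus (Fin 3) → EuclideanSpace ℝ (Fin 3)))).toReal + Torus.nsGeneratorPairing ν f u (Φ₁.grad u) +
          2 * θ₁ * (Torus.pairing (u : Lp (EuclideanSpace ℝ (Fin 3)) 2 (volume : Measure (UnitAddTorus (Fin 3)))) f - ν * (Torus.eGradNormSq ((u : Lp (EuclideanSpace ℝ (Fin 3)) 2 (volume : Measure (UnitAddTorus (Fin 3)))) : (UnitAddTorus (Fin 3) → EuclideanSpace ℝ (Fin 3)))).toReal) := by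
  have hU : Torus.IsSteadyWeakSolution 0 f U := isSteadyWeakSolution_zero_of_tendsto hν hu hlim
  refine floorFamily_false_of_tameApproach hf fun δ ν₀ hδ hν₀ => ?_
  have h1 : ∀ᶠ n in atTop, ν n < ν₀ := hν (Iio_mem_nhds hν₀)
  have h2 : ∀ᶠ n in atTop, dist (u n) U < δ := (tendsto_iff_dist_tendsto_zero.1 hlim) (Iio_mem_nhds hδ)
  obtain ⟨n, hn1, hn2⟩ := (h1.and h2).exists
  refine ⟨ν n, hνpos n, hn1, u n, huV n, hu n, U, hUV, hU, ?_⟩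
  rwa [dist_eq_norm] at hn2

/-- **A tame limit of steady states kills `X` at its force** (the `∀ ν`-body of
`FloorCertificateEnsembleCeiling` at `f`). -/
theorem xBody_false_of_tameLimit {f : (UnitAddTorus (Fin 3) → EuclideanSpace ℝ (Fin 3))} (hf : MemLp f 2 volume) {ν : ℕ → ℝ} {u : ℕ → Torus.energySpace (Fin 3)} {U : Torus.energySpace (Fin 3)}
    (hνpos : ∀ n, 0 < ν n) (hν : Tendsto ν atTop (𝓝 0))
    (huV : ∀ n, ((u n : Torus.energySpace (Fin 3)) : Lp (EuclideanSpace ℝ (Fin 3)) 2 (volume : Measure (UnitAddTorus (Fin 3)))) ∈ Torus.energySpaceV (Fin 3)) (hu : ∀ n, Torus.IsSteadyWeakSolution (ν n) f (u n))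
    (hUV : (U : Lp (EuclideanSpace ℝ (Fin 3)) 2 (volume : Measure (UnitAddTorus (Fin 3)))) ∈ Torus.energySpaceV (Fin 3)) (hlim : Tendsto u atTop (𝓝 U)) :
    ¬ ∃ (ε₀ E ν₀ : ℝ), 0 < ε₀ ∧ 0 < ν₀ ∧ ∀ ν : ℝ, 0 < ν → ν < ν₀ →
      (∃ (Φ₁ : Torus.CylindricalTest (Fin 3)) (θ₁ : ℝ), θ₁ ≤ 0 ∧ ∀ u : Torus.energySpace (Fin 3),
        Torus.eGradNormSq ((u : Lp (EuclideanSpace ℝ (Fin 3)) 2 (volume : Measure (UnitAddTorus (Fin 3)))) : (UnitAddTorus (Fin 3) → EuclideanSpace ℝ (Fin 3))) ≠ ⊤ → ‖u‖ ^ 2 ≤ 16 * (∫ x, ‖f x‖ ^ 2) / ν ^ 2 →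
        ε₀ ≤ ν * (Torus.eGradNormSq ((u : Lp (EuclideanSpace ℝ (Fin 3)) 2 (volume : Measure (UnitAddTorus (Fin 3)))) : (UnitAddTorus (Fin 3) → EuclideanSpace ℝ (Fin 3)))).toReal + Torus.nsGeneratorPairing ν f u (Φ₁.grad u) +
          2 * θ₁ * (Torus.pairing (u : Lp (EuclideanSpace ℝ (Fin 3)) 2 (volume : Measure (UnitAddTorus (Fin 3)))) f - ν * (Torus.eGradNormSq ((u : Lp (EuclideanSpace ℝ (Fin 3)) 2 (volume : Measure (UnitAddTorus (Fin 3)))) : (UnitAddTorus (Fin 3) → EuclideanSpace ℝ (Fin 3)))).toReal)) ∧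
      (∀ μ : Measure (Torus.energySpace (Fin 3)), Torus.IsStationaryStatisticalSolution ν f μ →
        Integrable (fun v : Torus.energySpace (Fin 3) => ‖v‖ ^ 2) μ → Torus.ensembleEnergy μ ≤ E) := by
  rintro ⟨ε₀, E, ν₀, hε₀, hν₀, h⟩
  exact floorFamily_false_of_tameLimit hf hνpos hν huV hu hUV hlim
    ⟨ε₀, ν₀, hε₀, hν₀, fun ν' hν' hνν₀ => (h ν' hν' hνν₀).1⟩

/-! ## The pincer form on `X` -/

/-- **If every admissible force has tame approach, `X` is false** (read on the crux itself; the hypothesis is a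
research statement about steady Navier–Stokes / forced steady Euler for EVERY smooth solenoidal mean-zero force,
recorded here as the exact shape a refutation of the FLOOR THESIS through steady states must take). -/
theorem floorCertificateEnsembleCeiling_false_of_forall_tameApproach
    (hall : ∀ f : (UnitAddTorus (Fin 3) → EuclideanSpace ℝ (Fin 3)), Torus.IsSmooth f → Torus.IsDivFree f → Torus.HasZeroMean f →
      ∀ δ ν₀ : ℝ, 0 < δ → 0 < ν₀ → ∃ ν : ℝ, 0 < ν ∧ ν < ν₀ ∧
        ∃ u : Torus.energySpace (Fin 3), (u : Lp (EuclideanSpace ℝ (Fin 3)) 2 (volume : Measure (UnitAddTorus (Fin 3)))) ∈ Torus.energySpaceV (Fin 3) ∧ Torus.IsSteadyWeakSolution ν f u ∧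
          ∃ U : Torus.energySpace (Fin 3), (U : Lp (EuclideanSpace ℝ (Fin 3)) 2 (volume : Measure (UnitAddTorus (Fin 3)))) ∈ Torus.energySpaceV (Fin 3) ∧ Torus.IsSteadyWeakSolution 0 f U ∧ ‖u - U‖ < δ) :
    ¬ FloorCertificateEnsembleCeiling := by
  rintro ⟨f, hfs, hfd, hfz, ε₀, E, ν₀, hε₀, hν₀, h⟩
  exact xBody_false_of_tameApproach (hfs.memLp 2) (hall f hfs hfd hfz) ⟨ε₀, E, ν₀, hε₀, hν₀, h⟩

end Summit.AnomalousDissipation.AnomalousDissipation.Theorems.FloorCertificateEnsembleCeiling.Negative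

end
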